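/-
Copyright (c) 2026 the pub-hodgecm-mathlib formalisation cell (harness21).  Prover seat hodgecm-mathlib-F0P2-p06 (g12), 2026-09-01.  Road «S3-ram» seeding wave (LEAD F0P3a-plan (g12)
T11-41; owner F0P3a-p06 (g15)); «O8c-ram» FILE 3: CLOSED FORMS of the two vertex-type H-profiles at a tame-ramified place (the `q`-sums of ★ p846978 at odd depth).
-/
import Mathlib.Data.Complex.Basic
import Mathlib.Algebra.Ring.GeomSum
import Mathlib.Algebra.BigOperators.Intervals
import Mathlib.Tactic
import HarnessLib

/-!
# Closed forms of the ramified vertex-type H-profiles `Y♮ 0`, `Y♮ 1` at odd depth `N = 2n + 1`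

Topic `NumberTheory/Rogawski1990`; namespace `Literature.NumberTheory.Rogawski1990`.  THEOREMS ONLY (no definition, no instance, no notation, no named fact, no `sorry`); kernel lane
`--supports stmt-HodgeConjecture-24833`.  Cell `pub/hodgecm-mathlib`, crux H413; road «S3-ram» seeding wave; organ **«O8c-ram» FILE 3 — CLOSED FORMS**.  ★ p846978
`DepthZeroTransferHValuesTypeOneRamified` (and its FILE 2 companion) give the stable orbital integrals of the two vertex-type indicators `1_{K⁰ × U₁}`, `1_{K♯ × U₁}` at a deep
type-(1) `γ_H` of depth `N` as the LITERAL `q`-sums of the ★ EDGE ∕ VERTEX pair theorems at window `m = 1`: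
`Y♮ π N = 2·Σ_{j ≤ N, j ≡ π (2), j + 1 ≤ N} w′_j + Σ_{i < 1} [i ≤ N ∧ N − i ≡ π (2)]·w′_{N−i}·(1 + 1)`, `w′_0 = 1`, `w′_j = 2q^{⌊j∕2⌋}` (`q = #𝓀_v`).  At a ramified place the depth
is ODD, `N = 2n + 1` (★ `odd_of_valuation_sub_eq_of_norm_one`), and then (this file, pure arithmetic, every `q : ℕ`):
  **`Y♮ 0 (2n+1) = 4·(1 + q + ⋯ + qⁿ) − 2`**,  **`Y♮ 1 (2n+1) = 4·(1 + q + ⋯ + qⁿ)`**, i.e. `(q − 1)·Y♮ 0 = 2(2qⁿ⁺¹ − q − 1)` and `(q − 1)·Y♮ 1 = 4(qⁿ⁺¹ − 1)`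
— the two ball sizes of [LabesseLanglands1979, §2 Lemma 2.1]'s ramified torus (`δ_m = 2q^m`): `1_{K⁰ × U₁}` counts the fixed EDGE MIDPOINTS, `1_{K♯ × U₁}` the fixed VERTICES of the
`(q+1)`-regular tree within distance `n` of the axis point (B-p14 (g38)'s certificate P1ram-T0 H-table `Y₀ = 2(2qⁿ⁺¹ − q − 1)∕(q − 1)`, `Y₁ = 4(qⁿ⁺¹ − 1)∕(q − 1)`, ref5 R-241).
HONEST LABEL: HC_CM is proved only modulo the cell's 2 remaining named inputs (hLiu418 24832, h413 24833) until rung 0 closes; this file is unconditional arithmetic.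

* §1 `sum_filter_range_succ_and_le_eq` (the redundant guard `j + 1 ≤ N` ⟺ `j < N`), `sum_filter_even_range_weight_eq` (`S₀(2n+1) = 1 + 2·Σ_{k<n} q^{k+1}`),
  `sum_filter_odd_range_weight_eq` (`S₁(2n+1) = 2·Σ_{k<n} q^k`), `window_weight_even_eq_zero`, `window_weight_odd_eq` (the window `i = 0` at odd `N`).
* §2 **`hProfile_zero_closedForm_of_odd`**, **`hProfile_one_closedForm_of_odd`** (the literal ℂ-valued profiles of ★ p846978 at `N = 2n+1`), and the `(q − 1)`-multiplied forms
  **`sub_one_mul_hProfile_zero_of_odd`**, **`sub_one_mul_hProfile_one_of_odd`**.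

## References
* [LabesseLanglands1979] J.-P. Labesse, R. P. Langlands, *L-indistinguishability for SL(2)*, Canad. J. Math. 31 (1979): §2 Lemma 2.1 pp. 8–9 (the ramified torus, `δ_m = 2q^m`).
* [Rogawski1990] J. D. Rogawski, *Automorphic Representations of Unitary Groups in Three Variables*, Ann. of Math. Stud. 123 (1990): §4.9 Lemma 4.9.3 p. 56.
* [Serre1980Trees] J.-P. Serre, *Trees* (1980): Ch. II §1.1 (balls in a biregular tree).
-/

set_option autoImplicit false

open Finset

namespace Literature.NumberTheory.Rogawski1990

/-! ## §1 The literal sums at odd depth -/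

/-- The guard `j + 1 ≤ N` inside `range (N + 1)` is `j < N`: the filtered sum is a sum over `range N`. [cite: LabesseLanglands1979, §2 Lemma 2.1 pp. 8–9] -/
theorem sum_filter_range_succ_and_le_eq (π N : ℕ) (f : ℕ → ℕ) :
    ∑ j ∈ (range (N + 1)).filter (fun j => j % 2 = π ∧ j + 1 ≤ N), f j = ∑ j ∈ (range N).filter (fun j => j % 2 = π), f j := by
  refine Finset.sum_congr ?_ fun _ _ => rfl
  ext j
  simp only [mem_filter, mem_range]
  constructor
  · rintro ⟨-, h2, h3⟩; exact ⟨by omega, h2⟩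
  · rintro ⟨h1, h2⟩; exact ⟨by omega, h2, by omega⟩

/-- **`S₀(2n+1) = 1 + 2(q + q² + ⋯ + qⁿ)`**: the even-indexed weights `w′_0 = 1`, `w′_{2k} = 2q^k` below `2n + 1`. [cite: LabesseLanglands1979, §2 Lemma 2.1 pp. 8–9] -/
theorem sum_filter_even_range_weight_eq (q n : ℕ) :
    ∑ j ∈ (range (2 * n + 1)).filter (fun j => j % 2 = 0), (if j = 0 then 1 else 2 * q ^ (j / 2)) = 1 + 2 * ∑ k ∈ range n, q ^ (k + 1) := by
  induction n with
  | zero => rw [Finset.sum_filter]; simp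
  | succ n ih =>
    rw [Finset.sum_filter] at ih ⊢
    rw [show 2 * (n + 1) + 1 = (2 * n + 1) + 1 + 1 by ring, sum_range_succ, sum_range_succ, ih, sum_range_succ]
    have h1 : ¬ ((2 * n + 1) % 2 = 0) := by omega
    have h2 : (2 * n + 1 + 1) % 2 = 0 := by omega
    have h3 : (2 * n + 1 + 1) ≠ 0 := by omega
    have h4 : (2 * n + 1 + 1) / 2 = n + 1 := by omega
    rw [if_neg h1, if_pos h2, if_neg h3, h4]
    ring

/-- **`S₁(2n+1) = 2(1 + q + ⋯ + qⁿ⁻¹)`**: the odd-indexed weights `w′_{2k+1} = 2q^k` below `2n + 1`. [cite: LabesseLanglands1979, §2 Lemma 2.1 pp. 8–9] -/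
theorem sum_filter_odd_range_weight_eq (q n : ℕ) :
    ∑ j ∈ (range (2 * n + 1)).filter (fun j => j % 2 = 1), (if j = 0 then 1 else 2 * q ^ (j / 2)) = 2 * ∑ k ∈ range n, q ^ k := by
  induction n with
  | zero => rw [Finset.sum_filter]; simp
  | succ n ih =>
    rw [Finset.sum_filter] at ih ⊢
    rw [show 2 * (n + 1) + 1 = (2 * n + 1) + 1 + 1 by ring, sum_range_succ, sum_range_succ, ih, sum_range_succ]
    have h1 : (2 * n + 1) % 2 = 1 := by omega
    have h1' : (2 * n + 1) ≠ 0 := by omega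
    have h2 : ¬ ((2 * n + 1 + 1) % 2 = 1) := by omega
    have h4 : (2 * n + 1) / 2 = n := by omega
    rw [if_pos h1, if_neg h1', if_neg h2, h4]
    ring

/-- The window term (`i = 0`) of the EDGE type vanishes at odd depth. [cite: LabesseLanglands1979, §2 Lemma 2.1 pp. 8–9] -/
theorem window_weight_even_eq_zero (q n : ℕ) :
    ∑ i ∈ range 1, (((if i ≤ 2 * n + 1 ∧ (2 * n + 1 - i) % 2 = 0 then (if 2 * n + 1 - i = 0 then 1 else 2 * q ^ ((2 * n + 1 - i) / 2)) else 0 : ℕ)) : ℂ) * (1 + 1) = 0 := by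
  rw [sum_range_one]
  have h : ¬ (0 ≤ 2 * n + 1 ∧ (2 * n + 1 - 0) % 2 = 0) := by omega
  rw [if_neg h, Nat.cast_zero, zero_mul]

/-- The window term (`i = 0`) of the VERTEX type at odd depth is `2qⁿ·2`. [cite: LabesseLanglands1979, §2 Lemma 2.1 pp. 8–9] -/
theorem window_weight_odd_eq (q n : ℕ) :
    ∑ i ∈ range 1, (((if i ≤ 2 * n + 1 ∧ (2 * n + 1 - i) % 2 = 1 then (if 2 * n + 1 - i = 0 then 1 else 2 * q ^ ((2 * n + 1 - i) / 2)) else 0 : ℕ)) : ℂ) * (1 + 1) =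
      4 * (q : ℂ) ^ n := by
  rw [sum_range_one]
  have h : (0 ≤ 2 * n + 1 ∧ (2 * n + 1 - 0) % 2 = 1) := by omega
  have h' : ¬ (2 * n + 1 - 0 = 0) := by omega
  have h4 : (2 * n + 1 - 0) / 2 = n := by omega
  rw [if_pos h, if_neg h', h4]
  push_cast
  ring

/-! ## §2 The closed forms -/

/-- **EDGE-TYPE PROFILE AT ODD DEPTH: `Y♮ 0 (2n+1) = 4(1 + q + ⋯ + qⁿ) − 2`** (the literal ℂ-valued profile of ★ `DepthZeroTransferHValuesTypeOneRamified` at `N = 2n + 1`).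
[cite: LabesseLanglands1979, §2 Lemma 2.1 pp. 8–9] [cite: Rogawski1990, §4.9 Lemma 4.9.3 p. 56] -/
theorem hProfile_zero_closedForm_of_odd (q n : ℕ) :
    (((2 * ∑ j ∈ (range (2 * n + 1 + 1)).filter (fun j => j % 2 = 0 ∧ j + 1 ≤ 2 * n + 1), (if j = 0 then 1 else 2 * q ^ (j / 2)) : ℕ)) : ℂ) +
        ∑ i ∈ range 1, (((if i ≤ 2 * n + 1 ∧ (2 * n + 1 - i) % 2 = 0 then (if 2 * n + 1 - i = 0 then 1 else 2 * q ^ ((2 * n + 1 - i) / 2)) else 0 : ℕ)) : ℂ) * (1 + 1) =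
      4 * (∑ k ∈ range (n + 1), (q : ℂ) ^ k) - 2 := by
  rw [window_weight_even_eq_zero, add_zero, sum_filter_range_succ_and_le_eq, sum_filter_even_range_weight_eq, sum_range_succ', pow_zero]
  push_cast
  ring

/-- **VERTEX-TYPE PROFILE AT ODD DEPTH: `Y♮ 1 (2n+1) = 4(1 + q + ⋯ + qⁿ)`** (the literal ℂ-valued profile of ★ `DepthZeroTransferHValuesTypeOneRamified` at `N = 2n + 1`).
[cite: LabesseLanglands1979, §2 Lemma 2.1 pp. 8–9] [cite: Rogawski1990, §4.9 Lemma 4.9.3 p. 56] -/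
theorem hProfile_one_closedForm_of_odd (q n : ℕ) :
    (((2 * ∑ j ∈ (range (2 * n + 1 + 1)).filter (fun j => j % 2 = 1 ∧ j + 1 ≤ 2 * n + 1), (if j = 0 then 1 else 2 * q ^ (j / 2)) : ℕ)) : ℂ) +
        ∑ i ∈ range 1, (((if i ≤ 2 * n + 1 ∧ (2 * n + 1 - i) % 2 = 1 then (if 2 * n + 1 - i = 0 then 1 else 2 * q ^ ((2 * n + 1 - i) / 2)) else 0 : ℕ)) : ℂ) * (1 + 1) =
      4 * ∑ k ∈ range (n + 1), (q : ℂ) ^ k := by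
  rw [window_weight_odd_eq, sum_filter_range_succ_and_le_eq, sum_filter_odd_range_weight_eq, sum_range_succ]
  push_cast
  ring

/-- **`(q − 1)·Y♮ 0 (2n+1) = 2(2qⁿ⁺¹ − q − 1)`** (B-p14's certificate form `Y₀ = 2(2qⁿ⁺¹ − q − 1)∕(q − 1)`). [cite: LabesseLanglands1979, §2 Lemma 2.1 pp. 8–9] -/
theorem sub_one_mul_hProfile_zero_of_odd (q n : ℕ) :
    ((q : ℂ) - 1) * ((((2 * ∑ j ∈ (range (2 * n + 1 + 1)).filter (fun j => j % 2 = 0 ∧ j + 1 ≤ 2 * n + 1), (if j = 0 then 1 else 2 * q ^ (j / 2)) : ℕ)) : ℂ) +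
        ∑ i ∈ range 1, (((if i ≤ 2 * n + 1 ∧ (2 * n + 1 - i) % 2 = 0 then (if 2 * n + 1 - i = 0 then 1 else 2 * q ^ ((2 * n + 1 - i) / 2)) else 0 : ℕ)) : ℂ) * (1 + 1)) =
      2 * (2 * (q : ℂ) ^ (n + 1) - q - 1) := by
  rw [hProfile_zero_closedForm_of_odd]
  have h := geom_sum_mul (q : ℂ) (n + 1)
  linear_combination 4 * h

/-- **`(q − 1)·Y♮ 1 (2n+1) = 4(qⁿ⁺¹ − 1)`** (B-p14's certificate form `Y₁ = 4(qⁿ⁺¹ − 1)∕(q − 1)`). [cite: LabesseLanglands1979, §2 Lemma 2.1 pp. 8–9] -/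
theorem sub_one_mul_hProfile_one_of_odd (q n : ℕ) :
    ((q : ℂ) - 1) * ((((2 * ∑ j ∈ (range (2 * n + 1 + 1)).filter (fun j => j % 2 = 1 ∧ j + 1 ≤ 2 * n + 1), (if j = 0 then 1 else 2 * q ^ (j / 2)) : ℕ)) : ℂ) +
        ∑ i ∈ range 1, (((if i ≤ 2 * n + 1 ∧ (2 * n + 1 - i) % 2 = 1 then (if 2 * n + 1 - i = 0 then 1 else 2 * q ^ ((2 * n + 1 - i) / 2)) else 0 : ℕ)) : ℂ) * (1 + 1)) =
      4 * ((q : ℂ) ^ (n + 1) - 1) := by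
  rw [hProfile_one_closedForm_of_odd]
  have h := geom_sum_mul (q : ℂ) (n + 1)
  linear_combination 4 * h

end Literature.NumberTheory.Rogawski1990
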